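import Literature.NumberTheory.EllipticCurves.IwasawaAlgebraSpecializationTorsionCountProofs
import Mathlib.RingTheory.DiscreteValuationRing.TFAE
import Mathlib.RingTheory.SimpleModule.Basic
import Mathlib.RingTheory.FiniteLength
import HarnessLib

/-!
# Howard's Eisenstein quotients `S_m = Λ/(T^m + p) = ℤ_p[π]` are discrete valuation rings with
# uniformiser `π = T mod q_m` and residue field of order `p`; `#N = p^{length N}` for finite-length
# `S_m`-modules (proofs file)

Topic `NumberTheory/EllipticCurves`. THEOREMS ONLY (no definition, no named fact, no instance, no
`sorry`), in the vocabulary of the tree (`IwasawaAlgebra p = ℤ_p⟦T⟧`; the quotient ring is always written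
`IwasawaAlgebra p ⧸ Ideal.span {X^m + C p}`).

WHAT. For `m ≥ 1` and `q_m = T^m + p`:
* §1 general local algebra: along a covering `A ⋖ B` of submodules over a local ring `R`,
  `#B = #A · #κ(R)` (`CovBy.natCard_eq_mul_natCard_residueField`), hence **`#M = #κ(R)^{length_R M}`
  for every `R`-module of finite length** (`natCard_eq_natCard_residueField_pow_length`) — the
  dictionary between LENGTH statements (Mastella–Zerman's Thm. 2.40: `ℓ(M) ≤ ℓ(H¹/𝓡κ(1))`) and the
  CARDINALITY currency of the tree's specialised Kolyvagin inequality;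
* §2 `S_m` is a domain, local, with maximal ideal `(π)`, `π := T mod q_m ≠ 0` non-unit
  (`maximalIdeal_quotient_X_pow_add_C_eq`), NOT a field, hence a DISCRETE VALUATION RING
  (`isDiscreteValuationRing_quotient_X_pow_add_C`; Noetherian local domain with principal maximal ideal,
  Mathlib's `IsDiscreteValuationRing.TFAE`) with uniformiser `π` (`irreducible_mk_X`);
* §3 its residue field has `p` elements (`natCard_residueField_quotient_X_pow_add_C`:
  `S_m/(π) = Λ/(T, p) = 𝔽_p`), so `#N = p^{length_{S_m} N}` for every `S_m`-module `N` of finite length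
  (`natCard_eq_pow_length_quotient_X_pow_add_C`), in particular for every FINITE `S_m`-module.

WHY (use). `S_m = ℤ_p[π]`, `π^m = −p`, is the coefficient ring of Howard's specialisation at the
height-one primes `𝔮 = q_m` through which the `μ`-part of his Theorem B is read off [Howard 2004, proof
of Thm. 2.2.10: "The case `𝔭 = pΛ` is dealt with in an entirely similar fashion, taking `𝔮 = T^m + p`";
"`S_𝔮` … a discrete valuation ring" in §2.2]; the DVR bound of a Kolyvagin system over `S_m` [Howard
Thm. 1.6.1; Mastella–Zerman 2026 Thm. 2.40] is a statement about LENGTHS of `S_m`-modules, while the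
tree's `m`-uniform inequality (`IwasawaAlgebra.lengthAt_le_two_mul_of_card_quotSMulTop_qm_le`, the
`SpecWitness` interface of crux idea `specialise-first-mu-x10b`) is in cardinalities: §3 converts one into
the other (`#M = p^{ℓ(M)}`), and §2 supplies the DVR structure every structure theorem over `S_m` needs
(cell `pub/bsd-print-x9`, supplement S2 of the K1 port). Pure commutative algebra.

References: [Howard2004HeegnerKolyvagin] Compositio Math. 140 (2004), §2.2 and proof of Thm. 2.2.10;
[MastellaZerman2026] arXiv:2505.08710, Thm. 2.40; [Washington1997] §7.1 (Prop. 7.2), §13.2 (Lemma 13.7,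
Prop. 13.8); [SerreLocalFields1979] I §6 (Eisenstein equations give totally ramified DVRs).
-/

noncomputable section

open scoped Classical
open IsLocalRing

universe u v

namespace Literature.NumberTheory.EllipticCurves

/-! ## §1 Local rings: `#B = #A · #κ` along a covering, `#M = #κ^{length M}` -/

namespace Module

/-- A FINITE module over any ring has finite length (it is Artinian and Noetherian).
[cite: Washington1997, §13.2] -/
theorem isFiniteLength_of_finite {R : Type u} [CommRing R] {M : Type v} [AddCommGroup M]
    [_root_.Module R M] [Finite M] : IsFiniteLength R M := by
  rw [isFiniteLength_iff_isNoetherian_isArtinian]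
  exact ⟨inferInstance, inferInstance⟩

variable {R : Type u} [CommRing R] [IsLocalRing R] {M : Type v} [AddCommGroup M] [_root_.Module R M]

/-- **Along a covering `A ⋖ B` of submodules over a local ring, `#B = #A · #κ(R)`**: the quotient `B/A` is
a simple module, hence isomorphic to `R/𝔪 = κ(R)`, and `#B = #A · #(B/A)`. (`Nat.card`, so the identity
also holds, trivially, when the modules are infinite.) [cite: Washington1997, §13.2 (lengths and orders of finite Λ-modules)] -/
theorem _root_.CovBy.natCard_eq_mul_natCard_residueField {A B : Submodule R M} (h : A ⋖ B) :
    Nat.card B = Nat.card A * Nat.card (ResidueField R) := by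
  let f : A →ₗ[R] B := Submodule.inclusion h.le
  have key : IsSimpleModule R (B ⧸ LinearMap.range f) := by
    rw [Submodule.range_inclusion, ← covBy_iff_quot_is_simple h.le]
    exact h
  obtain ⟨m, hm, ⟨e⟩⟩ := isSimpleModule_iff_quot_maximal.mp key
  rw [eq_maximalIdeal hm] at e
  have hinj : Function.Injective f := Submodule.inclusion_injective _
  rw [Submodule.card_eq_card_quotient_mul_card (LinearMap.range f),
    Nat.card_congr e.toEquiv, Nat.card_congr (LinearEquiv.ofInjective f hinj).toEquiv.symm]
  rfl

/-- **`#M = #κ(R)^{ℓ_R(M)}` for a module of finite length over a local ring** (induction along a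
composition series: each step is a covering and multiplies the cardinality by `#κ(R)`). With `Nat.card`
conventions the identity holds verbatim also for an infinite residue field.
[cite: Washington1997, §13.2 (lengths and orders of finite Λ-modules)] -/
theorem natCard_eq_natCard_residueField_pow_length (hM : IsFiniteLength R M) :
    Nat.card M = Nat.card (ResidueField R) ^ (Module.length R M).toNat := by
  obtain ⟨s, hs_bot, hs_top⟩ := isFiniteLength_iff_exists_compositionSeries.mp hM
  rw [← Module.length_compositionSeries s hs_bot hs_top]
  suffices ∀ k : Fin (s.length + 1), Nat.card (s k) = Nat.card (ResidueField R) ^ (k : ℕ) by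
    have hlast := this (Fin.last s.length)
    rw [Fin.val_last, ← RelSeries.last, hs_top] at hlast
    rw [ENat.toNat_coe, ← hlast]
    exact Nat.card_congr (Submodule.topEquiv (R := R) (M := M)).toEquiv.symm
  intro k
  induction k using Fin.induction with
  | zero =>
    have h0 : s 0 = ⊥ := by rw [← RelSeries.head, hs_bot]
    rw [h0]
    simp
  | succ i hi =>
    rw [(s.step i).natCard_eq_mul_natCard_residueField, hi, Fin.val_castSucc, Fin.val_succ, pow_succ]

end Module

/-! ## §2 `S_m = Λ/(q_m)` is a discrete valuation ring with uniformiser `π = T mod q_m` -/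

namespace IwasawaAlgebra

variable (p : ℕ) [hp : Fact p.Prime]

/-- `S_m = Λ/(q_m)` is a domain (`q_m` is a prime element of `Λ`, `m ≥ 1`).
[cite: Howard2004HeegnerKolyvagin, §2.2 (S_𝔮 for a height-one prime 𝔮)] [cite: Washington1997, §13.2] -/
theorem isDomain_quotient_X_pow_add_C {m : ℕ} (hm : 1 ≤ m) :
    IsDomain (IwasawaAlgebra p ⧸
      Ideal.span {(PowerSeries.X ^ m + PowerSeries.C (p : ℤ_[p]) : IwasawaAlgebra p)}) := by
  haveI : (Ideal.span {(PowerSeries.X ^ m + PowerSeries.C (p : ℤ_[p]) : IwasawaAlgebra p)}).IsPrime :=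
    (Ideal.span_singleton_prime (X_pow_add_C_ne_zero p m)).mpr (prime_X_pow_add_C p hm)
  exact Ideal.Quotient.isDomain _

/-- `S_m = Λ/(q_m)` is non-trivial (`q_m` is not a unit, `m ≥ 1`). [cite: Washington1997, §7.1] -/
theorem nontrivial_quotient_X_pow_add_C {m : ℕ} (hm : 1 ≤ m) :
    Nontrivial (IwasawaAlgebra p ⧸
      Ideal.span {(PowerSeries.X ^ m + PowerSeries.C (p : ℤ_[p]) : IwasawaAlgebra p)}) :=
  Ideal.Quotient.nontrivial_iff.mpr (by
    rw [Ne, Ideal.span_singleton_eq_top]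
    exact not_isUnit_X_pow_add_C p hm)

/-- `S_m = Λ/(q_m)` is a local ring (a non-trivial quotient of the local ring `Λ`).
[cite: Howard2004HeegnerKolyvagin, §2.2] [cite: Washington1997, §13.2] -/
theorem isLocalRing_quotient_X_pow_add_C {m : ℕ} (hm : 1 ≤ m) :
    IsLocalRing (IwasawaAlgebra p ⧸
      Ideal.span {(PowerSeries.X ^ m + PowerSeries.C (p : ℤ_[p]) : IwasawaAlgebra p)}) := by
  haveI := nontrivial_quotient_X_pow_add_C p hm
  exact IsLocalRing.of_surjective' (Ideal.Quotient.mk _) Ideal.Quotient.mk_surjective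

/-- `π = T mod q_m` is non-zero in `S_m` (`q_m ∤ T`). [cite: Washington1997, §7.1] -/
theorem mk_X_ne_zero {m : ℕ} (hm : 1 ≤ m) :
    (Ideal.Quotient.mk (Ideal.span {(PowerSeries.X ^ m + PowerSeries.C (p : ℤ_[p]) : IwasawaAlgebra p)})
      PowerSeries.X) ≠ 0 := by
  rw [Ne, Ideal.Quotient.eq_zero_iff_mem, Ideal.mem_span_singleton]
  have h := not_X_pow_add_C_dvd_X_pow p hm 1
  rwa [pow_one] at h

/-- `π = T mod q_m` is not a unit of `S_m`: a relation `T a − 1 ∈ (q_m)` is impossible (constant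
coefficients: `−1 = p · b₀`). [cite: Washington1997, §7.1] -/
theorem not_isUnit_mk_X {m : ℕ} (hm : 1 ≤ m) :
    ¬ IsUnit ((Ideal.Quotient.mk
      (Ideal.span {(PowerSeries.X ^ m + PowerSeries.C (p : ℤ_[p]) : IwasawaAlgebra p)})) PowerSeries.X) := by
  intro hu
  obtain ⟨v, hv⟩ := IsUnit.exists_right_inv hu
  obtain ⟨a, rfl⟩ := Ideal.Quotient.mk_surjective v
  rw [← map_mul, ← (Ideal.Quotient.mk _).map_one, Ideal.Quotient.eq, Ideal.mem_span_singleton] at hv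
  obtain ⟨b, hb⟩ := hv
  have h0 := congrArg PowerSeries.constantCoeff hb
  rw [map_sub, map_mul, PowerSeries.constantCoeff_X, zero_mul, map_one, map_mul, map_add, map_pow,
    PowerSeries.constantCoeff_X, zero_pow (by omega), zero_add, PowerSeries.constantCoeff_C] at h0
  -- `0 - 1 = p * b₀` in `ℤ_p`: impossible since `p` is not a unit
  have h1 : (p : ℤ_[p]) * (-PowerSeries.constantCoeff b) = 1 := by linear_combination h0
  exact PadicInt.irreducible_p.not_isUnit (IsUnit.of_mul_eq_one _ h1)

/-- **The maximal ideal of `S_m` is `(π)`, `π = T mod q_m`**: `π` is a non-unit, and a non-unit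
`a mod q_m` has constant coefficient `a(0) ∈ pℤ_p` (else `a = unit + T·a'` would be a unit of the local
ring `S_m`), so `a ≡ T·a' + p·b = T·a' − T^m·b (mod q_m)` lies in `(π)`.
[cite: Howard2004HeegnerKolyvagin, §2.2 (S_𝔮 a discrete valuation ring)] [cite: Washington1997, §7.1 and §13.2] -/
theorem maximalIdeal_quotient_X_pow_add_C_eq {m : ℕ} (hm : 1 ≤ m) :
    @IsLocalRing.maximalIdeal _ _ (isLocalRing_quotient_X_pow_add_C p hm) =
      Ideal.span {(Ideal.Quotient.mk
        (Ideal.span {(PowerSeries.X ^ m + PowerSeries.C (p : ℤ_[p]) : IwasawaAlgebra p)})) PowerSeries.X} := by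
  letI := isLocalRing_quotient_X_pow_add_C p hm
  apply le_antisymm
  · intro s hs
    rw [IsLocalRing.mem_maximalIdeal, mem_nonunits_iff] at hs
    obtain ⟨a, rfl⟩ := Ideal.Quotient.mk_surjective s
    -- split `a = C a₀ + X * a'`
    obtain ⟨a', ha'⟩ : ∃ a' : IwasawaAlgebra p, a = PowerSeries.C (PowerSeries.constantCoeff a) + PowerSeries.X * a' := by
      have hdvd : (PowerSeries.X : IwasawaAlgebra p) ∣ a - PowerSeries.C (PowerSeries.constantCoeff a) := by
        rw [PowerSeries.X_dvd_iff, map_sub, PowerSeries.constantCoeff_C, sub_self]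
      obtain ⟨a', h⟩ := hdvd
      exact ⟨a', by rw [← h]; ring⟩
    -- the constant coefficient is a non-unit of `ℤ_p`, i.e. a multiple of `p`
    have ha0 : ¬ IsUnit (PowerSeries.constantCoeff a) := by
      intro hu
      apply hs
      have hXmem : Ideal.Quotient.mk (Ideal.span {(PowerSeries.X ^ m + PowerSeries.C (p : ℤ_[p]) :
          IwasawaAlgebra p)}) (PowerSeries.X * a') ∈ IsLocalRing.maximalIdeal _ := by
        rw [map_mul]
        exact Ideal.mul_mem_right _ _ ((IsLocalRing.mem_maximalIdeal _).mpr (not_isUnit_mk_X p hm))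
      have hCunit : IsUnit (Ideal.Quotient.mk (Ideal.span {(PowerSeries.X ^ m + PowerSeries.C (p : ℤ_[p]) :
          IwasawaAlgebra p)}) (PowerSeries.C (PowerSeries.constantCoeff a))) :=
        (hu.map PowerSeries.C).map _
      by_contra hnot
      have hmem : Ideal.Quotient.mk _ a ∈ IsLocalRing.maximalIdeal _ := (IsLocalRing.mem_maximalIdeal _).mpr hnot
      rw [ha', map_add] at hmem
      have hC := Submodule.sub_mem _ hmem hXmem
      rw [add_sub_cancel_right] at hC
      exact (IsLocalRing.mem_maximalIdeal _).mp hC hCunit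
    have ha0' : PowerSeries.constantCoeff a ∈ IsLocalRing.maximalIdeal ℤ_[p] :=
      (IsLocalRing.mem_maximalIdeal _).mpr ha0
    rw [PadicInt.maximalIdeal_eq_span_p, Ideal.mem_span_singleton] at ha0'
    obtain ⟨b, hb⟩ := ha0'
    -- `C a₀ = C p * C b ≡ -X^m * C b (mod q_m)`
    rw [Ideal.mem_span_singleton]
    refine ⟨Ideal.Quotient.mk _ (a' - PowerSeries.X ^ (m - 1) * PowerSeries.C b), ?_⟩
    rw [← map_mul, Ideal.Quotient.eq, Ideal.mem_span_singleton]
    refine ⟨PowerSeries.C b, ?_⟩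
    have hXm : (PowerSeries.X : IwasawaAlgebra p) * PowerSeries.X ^ (m - 1) = PowerSeries.X ^ m := by
      rw [← pow_succ', Nat.sub_add_cancel hm]
    rw [ha', hb, map_mul]
    calc PowerSeries.C (p : ℤ_[p]) * PowerSeries.C b + PowerSeries.X * a' -
          PowerSeries.X * (a' - PowerSeries.X ^ (m - 1) * PowerSeries.C b)
        = PowerSeries.C (p : ℤ_[p]) * PowerSeries.C b + (PowerSeries.X * PowerSeries.X ^ (m - 1)) * PowerSeries.C b := by
          ring
      _ = (PowerSeries.X ^ m + PowerSeries.C (p : ℤ_[p])) * PowerSeries.C b := by rw [hXm]; ring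
  · rw [Ideal.span_singleton_le_iff_mem]
    exact (IsLocalRing.mem_maximalIdeal _).mpr (not_isUnit_mk_X p hm)

/-- `S_m` is not a field (`π ≠ 0` lies in the maximal ideal). [cite: Washington1997, §13.2] -/
theorem not_isField_quotient_X_pow_add_C {m : ℕ} (hm : 1 ≤ m) :
    ¬ IsField (IwasawaAlgebra p ⧸
      Ideal.span {(PowerSeries.X ^ m + PowerSeries.C (p : ℤ_[p]) : IwasawaAlgebra p)}) := by
  letI := isLocalRing_quotient_X_pow_add_C p hm
  rw [IsLocalRing.isField_iff_maximalIdeal_eq, maximalIdeal_quotient_X_pow_add_C_eq p hm,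
    Ideal.span_singleton_eq_bot]
  exact mk_X_ne_zero p hm

/-- **`S_m = Λ/(T^m + p) = ℤ_p[π]` is a discrete valuation ring** (`m ≥ 1`): a Noetherian local domain,
not a field, whose maximal ideal `(π)` is principal (Mathlib `IsDiscreteValuationRing.TFAE`).
[cite: Howard2004HeegnerKolyvagin, §2.2 (S_𝔮 a discrete valuation ring, finite and flat over ℤ_p)]
[cite: SerreLocalFields1979, I §6] [cite: Washington1997, §13.2] -/
theorem isDiscreteValuationRing_quotient_X_pow_add_C {m : ℕ} (hm : 1 ≤ m) :
    @IsDiscreteValuationRing (IwasawaAlgebra p ⧸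
      Ideal.span {(PowerSeries.X ^ m + PowerSeries.C (p : ℤ_[p]) : IwasawaAlgebra p)}) _
      (isDomain_quotient_X_pow_add_C p hm) := by
  letI := isDomain_quotient_X_pow_add_C p hm
  letI := isLocalRing_quotient_X_pow_add_C p hm
  have h := IsDiscreteValuationRing.TFAE (IwasawaAlgebra p ⧸
      Ideal.span {(PowerSeries.X ^ m + PowerSeries.C (p : ℤ_[p]) : IwasawaAlgebra p)})
    (not_isField_quotient_X_pow_add_C p hm)
  refine (h.out 0 4).mpr ?_
  rw [maximalIdeal_quotient_X_pow_add_C_eq p hm]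
  exact ⟨⟨_, rfl⟩⟩

/-- `π = T mod q_m` is a uniformiser of the DVR `S_m` (an irreducible element generating the maximal
ideal). [cite: Howard2004HeegnerKolyvagin, §2.2] [cite: SerreLocalFields1979, I §6] -/
theorem irreducible_mk_X {m : ℕ} (hm : 1 ≤ m) :
    Irreducible ((Ideal.Quotient.mk
      (Ideal.span {(PowerSeries.X ^ m + PowerSeries.C (p : ℤ_[p]) : IwasawaAlgebra p)})) PowerSeries.X) := by
  letI := isDomain_quotient_X_pow_add_C p hm
  letI := isLocalRing_quotient_X_pow_add_C p hm
  letI := isDiscreteValuationRing_quotient_X_pow_add_C p hm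
  exact (IsDiscreteValuationRing.irreducible_iff_uniformizer _).mpr
    (maximalIdeal_quotient_X_pow_add_C_eq p hm)

/-! ## §3 The residue field of `S_m` has `p` elements; `#N = p^{length N}` -/

/-- `(q_m, T) = (T, p)` in `Λ` (`m ≥ 1`: `T^m ∈ (T)`, and `p = q_m − T^m`). [cite: Washington1997, §7.1] -/
theorem span_X_pow_add_C_sup_span_X_eq {m : ℕ} (hm : 1 ≤ m) :
    Ideal.span {(PowerSeries.X ^ m + PowerSeries.C (p : ℤ_[p]) : IwasawaAlgebra p)} ⊔
        Ideal.span {(PowerSeries.X : IwasawaAlgebra p)} =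
      Ideal.span {(PowerSeries.X : IwasawaAlgebra p)} ⊔ Ideal.span {PowerSeries.C ((p : ℤ_[p]) ^ 1)} := by
  rw [pow_one]
  have hXm : (PowerSeries.X : IwasawaAlgebra p) ^ m ∈ Ideal.span {(PowerSeries.X : IwasawaAlgebra p)} := by
    rw [Ideal.mem_span_singleton]
    exact dvd_pow_self _ (by omega)
  apply le_antisymm
  · refine sup_le ?_ le_sup_left
    rw [Ideal.span_singleton_le_iff_mem]
    exact Submodule.add_mem _ (Ideal.mem_sup_left hXm) (Ideal.mem_sup_right (Ideal.mem_span_singleton_self _))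
  · refine sup_le le_sup_right ?_
    rw [Ideal.span_singleton_le_iff_mem]
    have h : (PowerSeries.X ^ m + PowerSeries.C (p : ℤ_[p]) : IwasawaAlgebra p) - PowerSeries.X ^ m ∈
        Ideal.span {(PowerSeries.X ^ m + PowerSeries.C (p : ℤ_[p]) : IwasawaAlgebra p)} ⊔
          Ideal.span {(PowerSeries.X : IwasawaAlgebra p)} :=
      Submodule.sub_mem _ (Ideal.mem_sup_left (Ideal.mem_span_singleton_self _)) (Ideal.mem_sup_right hXm)
    have e : (PowerSeries.X ^ m + PowerSeries.C (p : ℤ_[p]) : IwasawaAlgebra p) - PowerSeries.X ^ m =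
        PowerSeries.C (p : ℤ_[p]) := by ring
    rw [e] at h
    exact h

/-- `#(Λ/(q_m, T)) = p` (`= #(Λ/(T, p)) = #𝔽_p`). [cite: Washington1997, §7.1 and Prop. 13.8] -/
theorem natCard_quotient_span_X_pow_add_C_sup_span_X {m : ℕ} (hm : 1 ≤ m) :
    Nat.card (IwasawaAlgebra p ⧸ (Ideal.span {(PowerSeries.X ^ m + PowerSeries.C (p : ℤ_[p]) : IwasawaAlgebra p)} ⊔
        Ideal.span {(PowerSeries.X : IwasawaAlgebra p)})) = p := by
  rw [span_X_pow_add_C_sup_span_X_eq p hm]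
  have hX := isDistinguishedAt_X p
  haveI := free_quotient_pow p hX 1
  haveI := finite_quotient_pow p hX 1
  have h1 : Ideal.span {(PowerSeries.X : IwasawaAlgebra p)} =
      Ideal.span {((Polynomial.X : Polynomial ℤ_[p]) : IwasawaAlgebra p) ^ 1} := by
    rw [pow_one, Polynomial.coe_X]
  rw [h1, card_quotient_sup_span_C_pow, finrank_quotient_pow p hX 1, Polynomial.natDegree_X, one_mul,
    mul_one, pow_one]

/-- `#(S_m/(π)) = p`. [cite: Washington1997, §7.1 and Prop. 13.8] [cite: SerreLocalFields1979, I §6] -/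
theorem natCard_quotient_span_mk_X {m : ℕ} (hm : 1 ≤ m) :
    Nat.card ((IwasawaAlgebra p ⧸
        Ideal.span {(PowerSeries.X ^ m + PowerSeries.C (p : ℤ_[p]) : IwasawaAlgebra p)}) ⧸
      Ideal.span {(Ideal.Quotient.mk
        (Ideal.span {(PowerSeries.X ^ m + PowerSeries.C (p : ℤ_[p]) : IwasawaAlgebra p)})) PowerSeries.X}) = p := by
  have hmap : Ideal.span {(Ideal.Quotient.mk
        (Ideal.span {(PowerSeries.X ^ m + PowerSeries.C (p : ℤ_[p]) : IwasawaAlgebra p)})) PowerSeries.X} =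
      (Ideal.span {(PowerSeries.X : IwasawaAlgebra p)}).map (Ideal.Quotient.mk _) := by
    rw [Ideal.map_span, Set.image_singleton]
  rw [hmap, Nat.card_congr (DoubleQuot.quotQuotEquivQuotSup _ _).toEquiv]
  exact natCard_quotient_span_X_pow_add_C_sup_span_X p hm

/-- **The residue field of `S_m` has `p` elements** (`κ(S_m) = S_m/(π) = 𝔽_p`: `S_m/ℤ_p` is totally
ramified). [cite: SerreLocalFields1979, I §6] [cite: Howard2004HeegnerKolyvagin, §2.2] -/
theorem natCard_residueField_quotient_X_pow_add_C {m : ℕ} (hm : 1 ≤ m) :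
    Nat.card (@IsLocalRing.ResidueField _ _ (isLocalRing_quotient_X_pow_add_C p hm)) = p := by
  letI := isLocalRing_quotient_X_pow_add_C p hm
  change Nat.card ((IwasawaAlgebra p ⧸
      Ideal.span {(PowerSeries.X ^ m + PowerSeries.C (p : ℤ_[p]) : IwasawaAlgebra p)}) ⧸
    IsLocalRing.maximalIdeal _) = p
  rw [Nat.card_congr (Ideal.quotEquivOfEq (maximalIdeal_quotient_X_pow_add_C_eq p hm)).toEquiv]
  exact natCard_quotient_span_mk_X p hm

/-- **`#N = p^{ℓ(N)}` for every `S_m`-module `N` of finite length** — the dictionary between length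
statements over `S_m` (e.g. Mastella–Zerman's Thm. 2.40) and the cardinality currency of the tree's
specialised Kolyvagin inequality. [cite: MastellaZerman2026, Thm. 2.40] [cite: Washington1997, §13.2]
[cite: Howard2004HeegnerKolyvagin, proof of Thm. 2.2.10 (𝔮 = T^m + p)] -/
theorem natCard_eq_pow_length_quotient_X_pow_add_C {m : ℕ} (hm : 1 ≤ m) {N : Type v} [AddCommGroup N]
    [_root_.Module (IwasawaAlgebra p ⧸
      Ideal.span {(PowerSeries.X ^ m + PowerSeries.C (p : ℤ_[p]) : IwasawaAlgebra p)}) N]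
    (hN : IsFiniteLength (IwasawaAlgebra p ⧸
      Ideal.span {(PowerSeries.X ^ m + PowerSeries.C (p : ℤ_[p]) : IwasawaAlgebra p)}) N) :
    Nat.card N = p ^ (Module.length (IwasawaAlgebra p ⧸
      Ideal.span {(PowerSeries.X ^ m + PowerSeries.C (p : ℤ_[p]) : IwasawaAlgebra p)}) N).toNat := by
  letI := isLocalRing_quotient_X_pow_add_C p hm
  rw [Module.natCard_eq_natCard_residueField_pow_length hN, natCard_residueField_quotient_X_pow_add_C p hm]

/-- **`#N = p^{ℓ(N)}` for every FINITE `S_m`-module `N`.** [cite: MastellaZerman2026, Thm. 2.40]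
[cite: Washington1997, §13.2] -/
theorem natCard_eq_pow_length_quotient_X_pow_add_C_of_finite {m : ℕ} (hm : 1 ≤ m) {N : Type v}
    [AddCommGroup N]
    [_root_.Module (IwasawaAlgebra p ⧸
      Ideal.span {(PowerSeries.X ^ m + PowerSeries.C (p : ℤ_[p]) : IwasawaAlgebra p)}) N] [Finite N] :
    Nat.card N = p ^ (Module.length (IwasawaAlgebra p ⧸
      Ideal.span {(PowerSeries.X ^ m + PowerSeries.C (p : ℤ_[p]) : IwasawaAlgebra p)}) N).toNat :=
  natCard_eq_pow_length_quotient_X_pow_add_C p hm Module.isFiniteLength_of_finite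

/-- **Length comparison ⟹ cardinality comparison over `S_m`**: for finite `S_m`-modules `N, N'` and
`e : ℕ`, `ℓ(N) ≤ e · ℓ(N')` implies `#N ≤ #N'^e` — the form in which an error-free DVR Kolyvagin bound
`ℓ(M) ≤ ℓ(H¹/𝓡κ(1))` (twice, for `M ⊕ M`) becomes the field `#Xq_tors ≤ #(H/R∙κ₁)²` of the tree's witness
interface. [cite: MastellaZerman2026, Thm. 2.40] [cite: Howard2004HeegnerKolyvagin, Thm. 1.6.1] -/
theorem natCard_le_pow_of_length_le_mul {m : ℕ} (hm : 1 ≤ m) {N N' : Type v}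
    [AddCommGroup N] [AddCommGroup N']
    [_root_.Module (IwasawaAlgebra p ⧸
      Ideal.span {(PowerSeries.X ^ m + PowerSeries.C (p : ℤ_[p]) : IwasawaAlgebra p)}) N]
    [_root_.Module (IwasawaAlgebra p ⧸
      Ideal.span {(PowerSeries.X ^ m + PowerSeries.C (p : ℤ_[p]) : IwasawaAlgebra p)}) N']
    [Finite N] [Finite N'] (e : ℕ)
    (h : Module.length (IwasawaAlgebra p ⧸
        Ideal.span {(PowerSeries.X ^ m + PowerSeries.C (p : ℤ_[p]) : IwasawaAlgebra p)}) N ≤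
      e * Module.length (IwasawaAlgebra p ⧸
        Ideal.span {(PowerSeries.X ^ m + PowerSeries.C (p : ℤ_[p]) : IwasawaAlgebra p)}) N') :
    Nat.card N ≤ Nat.card N' ^ e := by
  rw [natCard_eq_pow_length_quotient_X_pow_add_C_of_finite p hm,
    natCard_eq_pow_length_quotient_X_pow_add_C_of_finite p hm (N := N'), ← pow_mul]
  apply Nat.pow_le_pow_right hp.out.pos
  have hN' : Module.length (IwasawaAlgebra p ⧸
      Ideal.span {(PowerSeries.X ^ m + PowerSeries.C (p : ℤ_[p]) : IwasawaAlgebra p)}) N' ≠ ⊤ :=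
    Module.length_ne_top_iff.mpr Module.isFiniteLength_of_finite
  have hN : Module.length (IwasawaAlgebra p ⧸
      Ideal.span {(PowerSeries.X ^ m + PowerSeries.C (p : ℤ_[p]) : IwasawaAlgebra p)}) N ≠ ⊤ :=
    Module.length_ne_top_iff.mpr Module.isFiniteLength_of_finite
  obtain ⟨a, ha⟩ := ENat.ne_top_iff_exists.mp hN
  obtain ⟨b, hb⟩ := ENat.ne_top_iff_exists.mp hN'
  rw [← ha, ← hb, ENat.toNat_coe, ENat.toNat_coe]
  rw [← ha, ← hb] at h
  have hab : a ≤ e * b := by exact_mod_cast h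
  rw [mul_comm]
  exact hab

end IwasawaAlgebra

end Literature.NumberTheory.EllipticCurves

end
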